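import Summits.Ventures.CertifiedArithmetic.LowPrec.SRHoeffdingFormats
import Summits.Ventures.CertifiedArithmetic.LowPrec.SRInnerProduct
import HarnessLib

/-!
# Exponential envelope for two-stage SR inner products, and its transfer to the certified formats

HONEST FRAMING: certified error envelopes and provably optimal rounding/accumulation schemes for
low-precision formats under stated cost models; every table by two implementations; no hardware or
vendor claims.

For the two-stage chain `ŝₖ₊₁ = SR(ŝₖ + SR(cₖ))` of `SRInnerProduct` (`cₖ` exact products, both
roundings saturating, all randomness fresh) we prove over `K = ℝ`, under `IPNoSat ∧ IPGapLE Gp Gs`: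

* `ipExp_exp_le` — `E_s[e^{t(ŝₙ − s − ∑cₖ)}] ≤ e^{n t²(Gp² + Gs²)/8}` (Hoeffding's lemma applied at the
  product rounding and at the sum rounding of every step, conditionally along the 4-ary outcome tree);
* `ip_prob_dev_ge_le_exp` — `P(|ŝₙ − s − ∑cₖ| ≥ t) ≤ 2 exp(−2t²/(n (Gp² + Gs²)))`;
* `ipGapLE_of_succ` — a spacing certificate of `F` gives `IPGapLE G G` for ALL product streams / starts;
* the cast transfer `ipExp_cast`, `ipNoSat_cast`, `ipGapLE_cast` and the format instances
  (`ip_prob_dev_ge_le_exp_rat`; E2M1/E3M2/E2M3/E4M3/E5M2 with `Gp = Gs = G` = 2, 4, 1/2, 32, 8192):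
  e.g. an E4M3 SR inner product of `n` terms with no saturating branch deviates from `∑ xₖyₖ` by `≥ t`
  with probability `≤ 2 exp(−t²/(1024 n))`.
-/

namespace Summit.Ventures.CertifiedArithmetic.LowPrec.SR

open Literature.ComputerArithmetic.ConnollyHighamMary2021 Finset Real

/-! ### Spacing certificate ⇒ `IPGapLE` for all inputs (any ordered field) -/

section Generic

variable {K : Type*} [Field K] [LinearOrder K] [IsStrictOrderedRing K]

/-- `IPGapLE G G` holds for ALL product streams and starts once `G ≥ 0` bounds the spacing of `F`. -/
theorem ipGapLE_of_succ {F : Finset K} (hF : F.Nonempty) {G : K} (hG : 0 ≤ G)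
    (hsucc : ∀ a ∈ F, a < F.max' hF → ∃ b ∈ F, a < b ∧ b ≤ a + G)
    (c : ℕ → K) (n : ℕ) (s : K) : IPGapLE F G G c n s := by
  induction n generalizing c s with
  | zero => trivial
  | succ n ih =>
      exact ⟨gap_le_of_succ hF hG hsucc (clamp_inHull hF _),
        ⟨gap_le_of_succ hF hG hsucc (clamp_inHull hF _), ih _ _, ih _ _⟩,
        ⟨gap_le_of_succ hF hG hsucc (clamp_inHull hF _), ih _ _, ih _ _⟩⟩

end Generic

/-! ### The moment generating function of the two-stage chain -/

/-- **MGF bound for SR inner products.** Under `IPNoSat ∧ IPGapLE Gp Gs`, for every real `t`,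
`E_s[e^{t(ŝₙ − s − ∑ₖ cₖ)}] ≤ e^{n t² (Gp² + Gs²)/8}`. -/
theorem ipExp_exp_le (F : Finset ℝ) (Gp Gs t : ℝ) :
    ∀ (n : ℕ) (c : ℕ → ℝ) (s : ℝ), IPNoSat F c n s → IPGapLE F Gp Gs c n s →
      ipExp F c n (fun v => exp (t * (v - (s + ∑ i ∈ range n, c i)))) s
        ≤ exp (n * (t ^ 2 * (Gp ^ 2 + Gs ^ 2) / 8)) := by
  intro n
  induction n with
  | zero => intro c s _ _; simp [ipExp]
  | succ n ih =>
      intro c s h hg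
      obtain ⟨hc0, ⟨hhu, hu1, hu2⟩, ⟨hhd, hd1, hd2⟩⟩ := h
      obtain ⟨hgp, ⟨hgsu, hg1, hg2⟩, ⟨hgsd, hg3, hg4⟩⟩ := hg
      simp only [ipExp, ipStep]
      rw [sum_range_succ' c n]
      set S := ∑ i ∈ range n, c (i + 1) with hS
      set B := exp (n * (t ^ 2 * (Gp ^ 2 + Gs ^ 2) / 8)) with hB
      have hcl0 : clamp F (c 0) = c 0 := clamp_eq_self hc0
      have leaf : ∀ a ℓ, IPNoSat F (fun i => c (i + 1)) n ℓ →
          IPGapLE F Gp Gs (fun i => c (i + 1)) n ℓ →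
          ipExp F (fun i => c (i + 1)) n (fun v => exp (t * (v - (s + (S + c 0))))) ℓ
            ≤ (exp (t * (a - c 0)) * exp (t * (ℓ - (s + a)))) * B := by
        intro a ℓ h1 h2
        have hf : (fun v => exp (t * (v - (s + (S + c 0)))))
            = fun v => (exp (t * (a - c 0)) * exp (t * (ℓ - (s + a))))
                * exp (t * (v - (ℓ + ∑ i ∈ range n, c (i + 1)))) := by
          funext v; rw [← exp_add, ← exp_add, ← hS]; ring_nf
        rw [hf, ipExp_mul_left]
        exact mul_le_mul_of_nonneg_left (ih _ _ h1 h2) (by positivity)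
      have inner : ∀ a, InHull F (s + a) →
          roundUp F (clamp F (s + a)) - roundDown F (clamp F (s + a)) ≤ Gs →
          IPNoSat F (fun i => c (i + 1)) n (up F (s + a)) →
          IPGapLE F Gp Gs (fun i => c (i + 1)) n (up F (s + a)) →
          IPNoSat F (fun i => c (i + 1)) n (dn F (s + a)) →
          IPGapLE F Gp Gs (fun i => c (i + 1)) n (dn F (s + a)) →
          step F (s + a) (ipExp F (fun i => c (i + 1)) n (fun v => exp (t * (v - (s + (S + c 0))))))
            ≤ (B * exp (t ^ 2 * Gs ^ 2 / 8)) * exp (t * (a - c 0)) := by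
        intro a hh hgs h1 g1 h2 g2
        have hcl : clamp F (s + a) = s + a := clamp_eq_self hh
        calc step F (s + a) (ipExp F (fun i => c (i + 1)) n
                (fun v => exp (t * (v - (s + (S + c 0))))))
            ≤ step F (s + a) (fun ℓ => (exp (t * (a - c 0)) * B)
                * exp (t * (ℓ - clamp F (s + a)))) := by
              refine step_mono_of F (s + a) ?_ ?_
              · rw [hcl]; exact (leaf a _ h1 g1).trans_eq (by ring)
              · rw [hcl]; exact (leaf a _ h2 g2).trans_eq (by ring)
          _ = (exp (t * (a - c 0)) * B) * step F (s + a) (fun ℓ => exp (t * (ℓ - clamp F (s + a)))) :=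
              step_mul_left F _ _ _
          _ ≤ (exp (t * (a - c 0)) * B) * exp (t ^ 2 * Gs ^ 2 / 8) :=
              mul_le_mul_of_nonneg_left (step_exp_le F (s + a) t hgs) (by positivity)
          _ = (B * exp (t ^ 2 * Gs ^ 2 / 8)) * exp (t * (a - c 0)) := by ring
      calc step F (c 0) (fun a => step F (s + a) (ipExp F (fun i => c (i + 1)) n
              (fun v => exp (t * (v - (s + (S + c 0)))))))
          ≤ step F (c 0) (fun a => (B * exp (t ^ 2 * Gs ^ 2 / 8)) * exp (t * (a - clamp F (c 0)))) := by
            refine step_mono_of F (c 0) ?_ ?_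
            · rw [hcl0]; exact inner _ hhu hgsu hu1 hg1 hu2 hg2
            · rw [hcl0]; exact inner _ hhd hgsd hd1 hg3 hd2 hg4
        _ = (B * exp (t ^ 2 * Gs ^ 2 / 8)) * step F (c 0) (fun a => exp (t * (a - clamp F (c 0)))) :=
            step_mul_left F _ _ _
        _ ≤ (B * exp (t ^ 2 * Gs ^ 2 / 8)) * exp (t ^ 2 * Gp ^ 2 / 8) :=
            mul_le_mul_of_nonneg_left (step_exp_le F (c 0) t hgp) (by positivity)
        _ = exp (↑(n + 1) * (t ^ 2 * (Gp ^ 2 + Gs ^ 2) / 8)) := by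
            rw [hB, ← exp_add, ← exp_add]; push_cast; ring_nf

/-! ### The exponential tail -/

/-- One-sided tails for the two-stage chain (`θ ≥ 0`). -/
theorem ip_prob_updev_le (F : Finset ℝ) (Gp Gs : ℝ) (c : ℕ → ℝ) (n : ℕ) (s : ℝ)
    (h : IPNoSat F c n s) (hg : IPGapLE F Gp Gs c n s) (t : ℝ) {θ : ℝ} (hθ : 0 ≤ θ) :
    ipExp F c n (upDevInd t (s + ∑ i ∈ range n, c i)) s
        ≤ exp (-(θ * t)) * exp (n * (θ ^ 2 * (Gp ^ 2 + Gs ^ 2) / 8)) ∧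
      ipExp F c n (dnDevInd t (s + ∑ i ∈ range n, c i)) s
        ≤ exp (-(θ * t)) * exp (n * (θ ^ 2 * (Gp ^ 2 + Gs ^ 2) / 8)) := by
  constructor
  · calc ipExp F c n (upDevInd t (s + ∑ i ∈ range n, c i)) s
        ≤ ipExp F c n (fun v => exp (-(θ * t)) * exp (θ * (v - (s + ∑ i ∈ range n, c i)))) s :=
          ipExp_mono F c n (fun v => upDevInd_le_exp t _ v hθ) s
      _ ≤ exp (-(θ * t)) * exp (n * (θ ^ 2 * (Gp ^ 2 + Gs ^ 2) / 8)) := by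
          rw [ipExp_mul_left]
          exact mul_le_mul_of_nonneg_left (ipExp_exp_le F Gp Gs θ n c s h hg) (exp_pos _).le
  · calc ipExp F c n (dnDevInd t (s + ∑ i ∈ range n, c i)) s
        ≤ ipExp F c n (fun v => exp (-(θ * t)) * exp (-θ * (v - (s + ∑ i ∈ range n, c i)))) s :=
          ipExp_mono F c n (fun v => dnDevInd_le_exp t _ v hθ) s
      _ ≤ exp (-(θ * t)) * exp (n * (θ ^ 2 * (Gp ^ 2 + Gs ^ 2) / 8)) := by
          rw [ipExp_mul_left]
          refine mul_le_mul_of_nonneg_left ?_ (exp_pos _).le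
          have := ipExp_exp_le F Gp Gs (-θ) n c s h hg
          rwa [neg_sq] at this

/-- **Exponential envelope for SR inner products in a finite format.** Under `IPNoSat ∧ IPGapLE Gp Gs`,
for every `t > 0`: `P(|ŝₙ − s − ∑ₖ cₖ| ≥ t) ≤ 2 exp(−2t²/(n (Gp² + Gs²)))`. -/
theorem ip_prob_dev_ge_le_exp (F : Finset ℝ) (Gp Gs : ℝ) (c : ℕ → ℝ) (n : ℕ) (s : ℝ)
    (h : IPNoSat F c n s) (hg : IPGapLE F Gp Gs c n s) (t : ℝ) (ht : 0 < t) :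
    ipExp F c n (devInd t (s + ∑ i ∈ range n, c i)) s
      ≤ 2 * exp (-2 * t ^ 2 / (n * (Gp ^ 2 + Gs ^ 2))) := by
  have hsplit : ipExp F c n (devInd t (s + ∑ i ∈ range n, c i)) s
      ≤ ipExp F c n (upDevInd t (s + ∑ i ∈ range n, c i)) s
        + ipExp F c n (dnDevInd t (s + ∑ i ∈ range n, c i)) s := by
    rw [← ipExp_add]; exact ipExp_mono F c n (fun v => devInd_le_up_add_dn t _ v) s
  by_cases hD : n * (Gp ^ 2 + Gs ^ 2) = 0
  · have h1 := ip_prob_updev_le F Gp Gs c n s h hg t le_rfl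
    simp only [zero_mul, neg_zero, exp_zero, one_mul, ne_eq, zero_pow, OfNat.ofNat_ne_zero,
      not_false_eq_true, zero_div, mul_zero] at h1
    rw [hD, div_zero, exp_zero, mul_one]
    linarith [h1.1, h1.2]
  · have hpos : 0 < n * (Gp ^ 2 + Gs ^ 2) := lt_of_le_of_ne (by positivity) (Ne.symm hD)
    set θ := 4 * t / (n * (Gp ^ 2 + Gs ^ 2)) with hθ
    have hθ0 : 0 ≤ θ := by positivity
    have h1 := ip_prob_updev_le F Gp Gs c n s h hg t hθ0
    have key : exp (-(θ * t)) * exp (n * (θ ^ 2 * (Gp ^ 2 + Gs ^ 2) / 8))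
        = exp (-2 * t ^ 2 / (n * (Gp ^ 2 + Gs ^ 2))) := by
      rw [← exp_add]; congr 1
      rw [hθ]; field_simp; ring
    rw [key] at h1
    linarith [h1.1, h1.2]

/-! ### Transfer along the cast `ℚ → ℝ` and the format instances -/

/-- The two-stage recursion commutes with the cast, for cast-compatible observables. -/
theorem ipExp_cast (F : Finset ℚ) (n : ℕ) (c : ℕ → ℚ) (s : ℚ) {f : ℚ → ℚ} {g : ℝ → ℝ}
    (hfg : ∀ v : ℚ, g (v : ℝ) = ((f v : ℚ) : ℝ)) :
    ipExp (realImage F) (fun i => (c i : ℝ)) n g (s : ℝ) = ((ipExp F c n f s : ℚ) : ℝ) := by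
  induction n generalizing c s with
  | zero => simp only [ipExp]; exact hfg s
  | succ n ih =>
      simp only [ipExp, ipStep]
      refine step_cast F (c 0) fun a => ?_
      rw [← Rat.cast_add]
      exact step_cast F (s + a) (fun v => ih (fun i => c (i + 1)) v)

/-- `IPNoSat` is invariant under the cast. -/
theorem ipNoSat_cast (F : Finset ℚ) :
    ∀ (n : ℕ) (c : ℕ → ℚ) (s : ℚ),
      IPNoSat (realImage F) (fun i => (c i : ℝ)) n (s : ℝ) ↔ IPNoSat F c n s := by
  intro n
  induction n with
  | zero => intro c s; simp [IPNoSat]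
  | succ n ih =>
      intro c s
      simp only [IPNoSat]
      rw [inHull_cast, up_cast, dn_cast, ← Rat.cast_add, ← Rat.cast_add, inHull_cast, inHull_cast,
        up_cast, dn_cast, up_cast, dn_cast, ih, ih, ih, ih]

/-- `IPGapLE` is invariant under the cast. -/
theorem ipGapLE_cast (F : Finset ℚ) (Gp Gs : ℚ) :
    ∀ (n : ℕ) (c : ℕ → ℚ) (s : ℚ),
      IPGapLE (realImage F) (Gp : ℝ) (Gs : ℝ) (fun i => (c i : ℝ)) n (s : ℝ) ↔ IPGapLE F Gp Gs c n s := by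
  intro n
  induction n with
  | zero => intro c s; simp [IPGapLE]
  | succ n ih =>
      intro c s
      simp only [IPGapLE]
      rw [up_cast, dn_cast, ← Rat.cast_add, ← Rat.cast_add, clamp_cast, clamp_cast, clamp_cast,
        roundUp_cast, roundDown_cast, roundUp_cast, roundDown_cast, roundUp_cast, roundDown_cast,
        up_cast, dn_cast, up_cast, dn_cast, ih, ih, ih, ih, ← Rat.cast_sub, ← Rat.cast_sub,
        ← Rat.cast_sub, Rat.cast_le, Rat.cast_le, Rat.cast_le]

/-- **Exponential envelope, rational two-stage chain.** -/
theorem ip_prob_dev_ge_le_exp_rat (F : Finset ℚ) (Gp Gs : ℚ) (c : ℕ → ℚ) (n : ℕ) (s : ℚ)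
    (h : IPNoSat F c n s) (hg : IPGapLE F Gp Gs c n s) (t : ℚ) (ht : 0 < t) :
    ((ipExp F c n (devInd t (s + ∑ i ∈ range n, c i)) s : ℚ) : ℝ)
      ≤ 2 * exp (-2 * (t : ℝ) ^ 2 / (n * ((Gp : ℝ) ^ 2 + (Gs : ℝ) ^ 2))) := by
  have hc := ipExp_cast F n c s (f := devInd t (s + ∑ i ∈ range n, c i))
    (g := devInd (t : ℝ) ((s + ∑ i ∈ range n, c i : ℚ) : ℝ)) (fun v => devInd_cast t _ v)
  rw [← hc]
  have h' := ip_prob_dev_ge_le_exp (realImage F) (Gp : ℝ) (Gs : ℝ) (fun i => (c i : ℝ)) n (s : ℝ)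
    ((ipNoSat_cast F n c s).mpr h) ((ipGapLE_cast F Gp Gs n c s).mpr hg) (t : ℝ) (by exact_mod_cast ht)
  have hsum : ((s + ∑ i ∈ range n, c i : ℚ) : ℝ) = (s : ℝ) + ∑ i ∈ range n, ((c i : ℚ) : ℝ) := by
    push_cast; rfl
  rw [hsum]
  exact h'

/-- E2M1 successor certificate (spacing `≤ 2`), by kernel decision. -/
theorem FP4.e2m1_max : FP4.e2m1.max' FP4.e2m1_nonempty = 6 := by decide +kernel

/-- E2M1 successor certificate (spacing `≤ 2`), by kernel decision. -/
theorem FP4.e2m1_succ : ∀ a ∈ FP4.e2m1, a < FP4.e2m1.max' FP4.e2m1_nonempty →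
    ∃ b ∈ FP4.e2m1, a < b ∧ b ≤ a + 2 := by
  rw [FP4.e2m1_max]; decide +kernel

/-- **E2M1 (FP4) inner products**: for every product stream and start, under `IPNoSat`,
`P(|ŝₙ − s − ∑cₖ| ≥ t) ≤ 2 exp(−t²/(4n))` (`Gp = Gs = 2`). -/
theorem fp4_ip_prob_dev_ge_le_exp (c : ℕ → ℚ) (n : ℕ) (s : ℚ) (h : IPNoSat FP4.e2m1 c n s)
    (t : ℚ) (ht : 0 < t) :
    ((ipExp FP4.e2m1 c n (devInd t (s + ∑ i ∈ range n, c i)) s : ℚ) : ℝ)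
      ≤ 2 * exp (-(t : ℝ) ^ 2 / (4 * n)) := by
  have := ip_prob_dev_ge_le_exp_rat FP4.e2m1 2 2 c n s h
    (ipGapLE_of_succ FP4.e2m1_nonempty (G := 2) (by norm_num) FP4.e2m1_succ c n s) t ht
  refine this.trans (le_of_eq ?_)
  congr 1; congr 1; push_cast; ring

/-- **E3M2 (FP6) inner products**: under `IPNoSat`, `P(|ŝₙ − s − ∑cₖ| ≥ t) ≤ 2 exp(−t²/(16n))`. -/
theorem e3m2_ip_prob_dev_ge_le_exp (c : ℕ → ℚ) (n : ℕ) (s : ℚ) (h : IPNoSat Formats.e3m2 c n s)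
    (t : ℚ) (ht : 0 < t) :
    ((ipExp Formats.e3m2 c n (devInd t (s + ∑ i ∈ range n, c i)) s : ℚ) : ℝ)
      ≤ 2 * exp (-(t : ℝ) ^ 2 / (16 * n)) := by
  have := ip_prob_dev_ge_le_exp_rat Formats.e3m2 4 4 c n s h
    (ipGapLE_of_succ Formats.e3m2_nonempty (G := 4) (by norm_num) Formats.e3m2_succ c n s) t ht
  refine this.trans (le_of_eq ?_)
  congr 1; congr 1; push_cast; ring

/-- **E2M3 (FP6) inner products**: under `IPNoSat`, `P(|ŝₙ − s − ∑cₖ| ≥ t) ≤ 2 exp(−4t²/n)`. -/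
theorem e2m3_ip_prob_dev_ge_le_exp (c : ℕ → ℚ) (n : ℕ) (s : ℚ) (h : IPNoSat Formats.e2m3 c n s)
    (t : ℚ) (ht : 0 < t) :
    ((ipExp Formats.e2m3 c n (devInd t (s + ∑ i ∈ range n, c i)) s : ℚ) : ℝ)
      ≤ 2 * exp (-(4 * (t : ℝ) ^ 2) / n) := by
  have := ip_prob_dev_ge_le_exp_rat Formats.e2m3 (1/2) (1/2) c n s h
    (ipGapLE_of_succ Formats.e2m3_nonempty (G := 1/2) (by norm_num) Formats.e2m3_succ c n s) t ht
  refine this.trans (le_of_eq ?_)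
  congr 1; congr 1; push_cast; ring

/-- **E4M3 (OCP FP8) inner products**: under `IPNoSat`, `P(|ŝₙ − s − ∑cₖ| ≥ t) ≤ 2 exp(−t²/(1024n))`. -/
theorem e4m3_ip_prob_dev_ge_le_exp (c : ℕ → ℚ) (n : ℕ) (s : ℚ) (h : IPNoSat Formats.e4m3 c n s)
    (t : ℚ) (ht : 0 < t) :
    ((ipExp Formats.e4m3 c n (devInd t (s + ∑ i ∈ range n, c i)) s : ℚ) : ℝ)
      ≤ 2 * exp (-(t : ℝ) ^ 2 / (1024 * n)) := by
  have := ip_prob_dev_ge_le_exp_rat Formats.e4m3 32 32 c n s h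
    (ipGapLE_of_succ Formats.e4m3_nonempty (G := 32) (by norm_num) Formats.e4m3_succ c n s) t ht
  refine this.trans (le_of_eq ?_)
  congr 1; congr 1; push_cast; ring

/-- **E5M2 (OCP FP8, finite part) inner products**: under `IPNoSat`,
`P(|ŝₙ − s − ∑cₖ| ≥ t) ≤ 2 exp(−t²/(2²⁶ n))`. -/
theorem e5m2_ip_prob_dev_ge_le_exp (c : ℕ → ℚ) (n : ℕ) (s : ℚ) (h : IPNoSat Formats.e5m2 c n s)
    (t : ℚ) (ht : 0 < t) :
    ((ipExp Formats.e5m2 c n (devInd t (s + ∑ i ∈ range n, c i)) s : ℚ) : ℝ)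
      ≤ 2 * exp (-(t : ℝ) ^ 2 / (67108864 * n)) := by
  have := ip_prob_dev_ge_le_exp_rat Formats.e5m2 8192 8192 c n s h
    (ipGapLE_of_succ Formats.e5m2_nonempty (G := 8192) (by norm_num) Formats.e5m2_succ c n s) t ht
  refine this.trans (le_of_eq ?_)
  congr 1; congr 1; push_cast; ring

end Summit.Ventures.CertifiedArithmetic.LowPrec.SR
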